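import Literature.Probability.Percolation.KSTPeriodicWeak
import HarnessLib

/-!
# KST-type RSW for periodic measures: assembly from the positive-scale cascading step

Topic `Literature/Probability/Percolation`. The assembly `weakPeriodicRSW_of` of
`KSTPeriodicWeak.lean` ([KohlerSchindlerTassion2023, Theorem 1 under Comment 1], from the five
steps) only ever applies the cascading step (Lemma 4) at the scales `M₀ 4ⁱ ≥ 1`; this file records
the same assembly from the positive-scale form `CascadeStepPos` of Lemma 4 (the form proved in
`KSTPeriodicCascadeStep.lean`), verbatim except for the extra positivity witness.

## References

* [KohlerSchindlerTassion2023] L. Köhler-Schindler, V. Tassion, *Crossing probabilities for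
  planar percolation*, Duke Math. J. 172 (2023), Theorem 1, §2, §5; Comment 1.
-/

namespace Literature.Probability.Percolation

open LatticeModels SimpleGraph _root_.MeasureTheory

noncomputable section

namespace KSTPeriodic

/-- **The weak periodic RSW theorem from its steps, positive-scale cascading** ([KohlerSchindlerTassion2023], proof of
Theorem 1 in §5.2, run with constants as in §2): arms from short crossings, quasi-crossings from
arms, the closing and cascading inequalities, and long crossings from bridges imply
`WeakPeriodicRSW k t`. The cascade runs along the scales `M₀ · 4ⁱ`; its base bridge bound comes
from the row finite-energy hypothesis (an open row segment across the base box is a bridge).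
[cite: KohlerSchindlerTassion2023, Theorem 1, §2 and §5.2] -/
theorem weakPeriodicRSW_of_pos {k t : ℕ} (hk : 1 ≤ k) (hA : ArmsOfShortCrossings k t)
    (hQ : QuasiOfArms k t) (hC : ClosingIneq k t) (hS : CascadeStepPos k t)
    (hB : BridgesGiveCrossings k t) : WeakPeriodicRSW k t := by
  intro ε p₀ hε hp₀ N₀ ρ hρ
  -- Lemma 1(ii): arms
  obtain ⟨a₀, ha₀, N₁, hA'⟩ := hA ε hε N₀
  -- Lemma 3: quasi-crossings between adjacent scales
  obtain ⟨s₀, hs₀, N₂, hQ'⟩ := hQ a₀ ha₀ N₁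
  -- the base scale: a multiple of `1536 k` above every threshold
  set M₀ : ℕ := 1536 * k * (N₀ + N₁ + N₂ + k + 1) with hM₀
  have hMpos : 1 ≤ M₀ := by
    have : 1 ≤ 1536 * k * (N₀ + N₁ + N₂ + k + 1) := Nat.one_le_iff_ne_zero.2 (by positivity)
    simpa [hM₀] using this
  have hMdiv : 1536 * k ∣ M₀ := ⟨N₀ + N₁ + N₂ + k + 1, by rw [hM₀]⟩
  have hMge : N₀ + N₁ + N₂ + k + 1 ≤ M₀ := by
    rw [hM₀]; exact Nat.le_mul_of_pos_left _ (by omega)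
  -- the scales `mᵢ = M₀ 4ⁱ`
  let sc : ℕ → ℕ := fun i => M₀ * 4 ^ i
  have hsc_div : ∀ i, 1536 * k ∣ sc i := fun i => Dvd.dvd.mul_right hMdiv _
  have hsc_ge : ∀ i, M₀ ≤ sc i := fun i => Nat.le_mul_of_pos_right _ (by positivity)
  have hsc_succ : ∀ i, sc (i + 1) = 4 * sc i := fun i => by simp only [sc, pow_succ]; ring
  have hsc_mono : ∀ {i j}, i ≤ j → sc i ≤ sc j := fun h => Nat.mul_le_mul_left _ (Nat.pow_le_pow_right (by norm_num) h)
  -- cascade constants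
  set s₁ : ℝ := min s₀ 1 with hs₁
  have hs₁pos : 0 < s₁ := lt_min hs₀ one_pos
  have hs₁le : s₁ ≤ 1 := min_le_right _ _
  set θ₀ : ℝ := 1 - Real.sqrt (1 - s₁) with hθ₀
  have hθ₀pos : 0 < θ₀ := theta_pos hs₁pos
  set L₀ : ℕ := 2 * (M₀ + M₀ / 12) + t with hL₀
  set pb : ℝ := p₀ ^ L₀ with hpb
  have hpbpos : 0 < pb := pow_pos hp₀ _
  set cb : ℝ := θ₀ * min (θ₀ ^ 2 / 4) pb with hcb
  have hcbpos : 0 < cb := mul_pos hθ₀pos (lt_min (by positivity) hpbpos)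
  -- Lemma 1(i),(iii): long crossings from bridges, at aspect ratio `4ρ`
  obtain ⟨c₀, hc₀, hB'⟩ := hB cb hcbpos (4 * ρ) (by omega)
  refine ⟨c₀, hc₀, M₀, fun μ _ hμ hLμ hcross hrow N hN => ?_⟩
  -- the given data at this measure
  have harm : ∀ n : ℕ, N₁ ≤ n → 64 * k ∣ n → a₀ ≤ μ.real (arm t (n / 64) n) := hA' μ hμ hLμ hcross
  have hquasi : ∀ m : ℕ, N₂ ≤ m → 1536 * k ∣ m → s₀ ≤ μ.real (quasi t (m + k) (4 * m) (m / 12) m) :=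
    hQ' μ hμ hLμ harm
  -- the sequences of the cascade
  let q : ℕ → ℕ → ℝ := fun i j => μ.real (quasi t (sc i / 4 + k) (sc i) (sc j / 12) (sc j))
  let b : ℕ → ℝ := fun i => μ.real (bridge t (sc i / 12) (sc i))
  have hq0 : ∀ i j, 0 ≤ q i j := fun i j => measureReal_nonneg
  have hb0 : ∀ i, 0 ≤ b i := fun i => measureReal_nonneg
  -- (P1) adjacent quasi-crossings
  have hP1 : ∀ i, s₁ ≤ q (i + 1) i := by
    intro i
    have hN₂ : N₂ ≤ sc i := by have := hsc_ge i; omega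
    have h := hquasi (sc i) hN₂ (hsc_div i)
    have h4 : sc (i + 1) / 4 = sc i := by rw [hsc_succ]; omega
    simp only [q]
    rw [h4, hsc_succ]
    exact (min_le_left _ _).trans h
  -- divisibility by `12 k` and `12`
  have h12k : ∀ i, 12 * k ∣ sc i := fun i => Dvd.dvd.trans ⟨128, by ring⟩ (hsc_div i)
  have h12 : ∀ i, 12 ∣ sc i := fun i => Dvd.dvd.trans ⟨k, by ring⟩ (h12k i)
  -- (P2) cascading
  have hP2 : ∀ i l j, j ≤ l → l ≤ i →
      (1 - Real.sqrt (1 - q i l)) ≤ q i j ∨ (1 - Real.sqrt (1 - q i l)) * q l j ≤ 1 - (1 - b l) ^ 2 :=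
    fun i l j hjl hli => hS μ hμ hLμ (sc i) (sc l) (sc j)
      (Nat.lt_of_lt_of_le Nat.one_pos (hMpos.trans (hsc_ge j))) (hsc_mono hjl) (hsc_mono hli)
      (h12k j) (h12k l) (h12k i)
  -- (P3) closing
  have hP3 : ∀ i j, j ≤ i → q i j * b j ≤ b i :=
    fun i j hji => hC μ hμ hLμ (sc i) (sc j) (hsc_mono hji) (h12 j) (h12 i)
  -- base: an open row segment across the base bridge box
  have hbase : pb ≤ b 0 := by
    obtain ⟨y, hy⟩ := hrow
    -- move the row `y` into `[-M₀ - t, M₀]` by a translation of `kℤ²`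
    obtain ⟨j, hj1, hj2⟩ : ∃ j : ℤ, -(M₀ : ℤ) - t ≤ y + k * j ∧ y + k * j ≤ M₀ := by
      have hk0 : (k : ℤ) ≠ 0 := by exact_mod_cast (show k ≠ 0 by omega)
      have hkpos : (0 : ℤ) < k := by exact_mod_cast (show 0 < k by omega)
      have hkM : (k : ℤ) ≤ M₀ := by exact_mod_cast (show k ≤ M₀ by omega)
      refine ⟨-(y / k), ?_, ?_⟩
      · have h1 := Int.emod_nonneg y hk0
        have h2 := Int.emod_add_mul_ediv y k
        nlinarith
      · have h1 := Int.emod_lt_of_pos y hkpos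
        have h2 := Int.emod_add_mul_ediv y k
        nlinarith
    have hshift := real_rowSegment_shift hμ ![0, j] (-((M₀ : ℤ) + M₀ / 12) - t) y L₀
    simp only [Matrix.cons_val_zero, mul_zero, add_zero, Matrix.cons_val_one] at hshift
    have hseg := hy (-((M₀ : ℤ) + M₀ / 12) - t) L₀
    rw [← hshift] at hseg
    refine hseg.trans (measureReal_mono ?_)
    intro ω hω
    have hsc0 : sc 0 = M₀ := by simp [sc]
    simp only [hsc0]
    refine bridge_of_rowSegment (y := y + k * j) hj1 hj2 ?_
    intro i hi
    have := hω i (by rw [hL₀]; omega)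
    push_cast at this ⊢
    exact this
  -- the cascade
  have hcas : ∀ i, cb ≤ b i := fun i =>
    cascade_bound hs₁pos hs₁le hq0 hb0 hP1 hP2 hP3 hpbpos.le hbase i
  -- the scale `mᵢ ≤ N < 4 mᵢ`
  obtain ⟨i, hi1, hi2⟩ : ∃ i, sc i ≤ N ∧ N < 4 * sc i := by
    classical
    have hex : ∃ i, N < 4 * sc i := by
      refine ⟨N, ?_⟩
      have : N < 4 ^ (N + 1) :=
        (Nat.lt_pow_self (by norm_num)).trans (Nat.pow_lt_pow_right (by norm_num) (by omega))
      calc N < 4 ^ (N + 1) := this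
        _ = 4 * 4 ^ N := by ring
        _ ≤ 4 * (M₀ * 4 ^ N) := Nat.mul_le_mul_left _ (Nat.le_mul_of_pos_left _ (by omega))
    refine ⟨Nat.find hex, ?_, Nat.find_spec hex⟩
    by_cases h0 : Nat.find hex = 0
    · have : sc (Nat.find hex) = M₀ := by rw [h0]; simp [sc]
      omega
    · have hpos : 0 < Nat.find hex := Nat.pos_of_ne_zero h0
      have hprev : ¬ (N < 4 * sc (Nat.find hex - 1)) := Nat.find_min hex (by omega)
      have heq : sc (Nat.find hex) = 4 * sc (Nat.find hex - 1) := by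
        rw [← hsc_succ, Nat.sub_add_cancel hpos]
      omega
  -- long crossing at scale `mᵢ`, then monotonicity
  have h768 : 768 * k ∣ sc i := Dvd.dvd.trans ⟨2, by ring⟩ (hsc_div i)
  have hlong : c₀ ≤ μ.real (crossing t (4 * ρ * sc i) (sc i)) :=
    hB' μ hμ hLμ (sc i) (hMpos.trans (hsc_ge i)) h768 (hcas i)
  refine hlong.trans (real_crossing_mono hLμ ?_ hi1)
  nlinarith

end KSTPeriodic

end

end Literature.Probability.Percolation
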